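import Summits.CriticalPhenomena.Ising3DConformalLimit.Theses.GaussianScaleMixture
import Summits.CriticalPhenomena.Ising3DConformalLimit.Theorems.HyperoctahedralRPHRP2Rigidity
import HarnessLib

/-!
# Route GaussianScaleMixture — crux `GSMRigidity` (stmt-CriticalPhenomena-8366): PROOF

THEOREM-ONLY file (no definitions, no named facts).

`GSMRigidity` (item r3 of route GaussianScaleMixture, card K2 = "DQR", kernel form) asks: every
continuous positive kernel `K` on `ℝ³∖0`, homogeneous of degree `-2Δ` with `1/2 ≤ Δ ≤ 1`, invariant
and reflection positive (finite point configurations in the open half-space) for the nine lattice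
mirror normals `eᵢ, eᵢ ± eⱼ`, which is MOREOVER a Gaussian scale mixture off the origin, is invariant
under every linear isometry of `ℝ³`.

Its hypotheses are those of the sibling crux `HyperoctahedralRP.HRP2Rigidity`
(stmt-CriticalPhenomena-1979) VERBATIM, plus one more (the Gaussian-scale-mixture representation);
the conclusions coincide.  `HRP2Rigidity` is now an unconditional theorem of the tree —
`Summit.CriticalPhenomena.Ising3DConformalLimit.Cruxes.HRP2Rigidity.XRayMellin.HRP2Rigidity_of`
(`Theorems/HyperoctahedralRPHRP2Rigidity.lean`, p77144, line `xray-mellin-transfer`: half-line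
Bernstein–Widder continuation, strip tiling of the complexified polar angle, periodic-type Liouville,
probed X-ray transfer `d = 3 ⇒ d = 2`, Mellin axial symmetry; axioms `propext`, `Classical.choice`,
`Quot.sound`) — so the crux follows by dropping the extra hypothesis.  This is the one-line corollary
foreseen in the route file ("HRP2Rigidity proved elsewhere moots GSMRigidity") and recorded as a
kernel-checked `example` in the line skeleton `Cruxes/GSMRigidity/Lines/momentum-one-amplitude.lean`
(logically: `HRP2Rigidity → GSMRigidity` by `fun h Δ K h₁ h₂ hc hp hh h9 _ => h Δ K h₁ h₂ hc hp hh h9`).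

What is deliberately NOT here: the GSM-specific closings of the three crux lines
(`momentum-one-amplitude`, `swap-pencil-branch-arc`, `tilted-lightcone-jump-positivity`) — they prove
the same statement by other means and are superseded for the purpose of closing the item; the
GSM-cone by-products that are NOT implied by `HRP2Rigidity` (one-amplitude isotropy, Schur order) are
separate support items of the route (stmt-8369 is landed: `Theorems/GaussianScaleMixtureOneAmplitudeIsotropy.lean`).
-/

namespace Summit.CriticalPhenomena.Ising3DConformalLimit.Theorems

/-- **`GSMRigidity` (stmt-CriticalPhenomena-8366), proved.**  A continuous positive kernel on `ℝ³∖0`,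
homogeneous of degree `-2Δ` (`1/2 ≤ Δ ≤ 1`), invariant and reflection positive for the nine lattice
mirrors `eᵢ, eᵢ ± eⱼ`, and a Gaussian scale mixture off the origin, is invariant under every linear
isometry.  Proof: the Gaussian-scale-mixture hypothesis is discarded and the remaining hypotheses are
exactly those of `HyperoctahedralRP.HRP2Rigidity`, an unconditional theorem of the tree
(`Cruxes.HRP2Rigidity.XRayMellin.HRP2Rigidity_of`). -/
theorem gsmRigidity_proof :
    Summit.CriticalPhenomena.Ising3DConformalLimit.Theses.GaussianScaleMixture.GSMRigidity := by
  unfold Summit.CriticalPhenomena.Ising3DConformalLimit.Theses.GaussianScaleMixture.GSMRigidity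
  intro Δ K hΔ1 hΔ2 hKc hKp hKhom hnine _hgsm
  exact Summit.CriticalPhenomena.Ising3DConformalLimit.Cruxes.HRP2Rigidity.XRayMellin.HRP2Rigidity_of
    Δ K hΔ1 hΔ2 hKc hKp hKhom hnine

end Summit.CriticalPhenomena.Ising3DConformalLimit.Theorems
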